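import Literature.Probability.RandomPlanarGeometry.LoewnerRemainingHull
import Mathlib.Topology.Order.MonotoneContinuity
import HarnessLib

/-!
# The through-swallow capacity clock: monotonicity, continuity, inverse

Topic `Probability/RandomPlanarGeometry`; theorems only (crux `stmt-CriticalPhenomena-0698`, stub
`stub_isLocal`, through-swallow image chain of the locality of SLE₆). The clock API of
`LoewnerImageClock.lean` for the through-swallow clock `σ(t) = thrClock W A t = ∫₀ᵗ d_r² dr`
(`LoewnerRemainingHull.lean`), under the single hypothesis that the rate is integrable on `[0, β]`
(through the swallow instants the rate `d_r² = Φ'_{B_r}(0)² ∈ (0, 1]` is only piecewise continuous and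
has NO positive lower bound — a collapsing piece kills `Φ'(0)` —, so the inverse clock is continuous but
not Lipschitz): `thrClock` is `1`-Lipschitz and strictly increasing on `[0, β]`, its inverse
`thrClockInv W A β` is a strictly increasing continuous inverse on `[0, σ β]` (continuity of a monotone
surjection onto an interval, `Mathlib.Topology.Order.MonotoneContinuity`), and the `ℝ≥0` versions
`thrClockC`.
-/

noncomputable section

open Set Filter Topology Function MeasureTheory intervalIntegral
open scoped NNReal

namespace Literature.Probability.RandomPlanarGeometry

namespace Loewner

variable {W : ℝ≥0 → ℝ} {A : Set ℂ}

section Clock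

variable {β : ℝ≥0} (hint : IntegrableOn (thrClockRate W A) (Icc (0 : ℝ) β))
include hint

/-- The rate is interval integrable on subintervals of `[0, β]`. [folklore] -/
theorem intervalIntegrable_thrClockRate {a b : ℝ} (ha : a ∈ Icc (0 : ℝ) β) (hb : b ∈ Icc (0 : ℝ) β) :
    IntervalIntegrable (thrClockRate W A) volume a b :=
  (hint.mono_set (uIcc_subset_Icc ha hb)).intervalIntegrable

/-- **Increments of the clock**: for `0 ≤ t < t' ≤ β`, `0 < σ t' − σ t ≤ t' − t`. [folklore] -/
theorem thrClock_sub_mem {t t' : ℝ} (ht : 0 ≤ t) (htt' : t < t') (ht' : t' ≤ β) :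
    0 < thrClock W A t' - thrClock W A t ∧ thrClock W A t' - thrClock W A t ≤ t' - t := by
  have htI : t ∈ Icc (0 : ℝ) β := ⟨ht, htt'.le.trans ht'⟩
  have ht'I : t' ∈ Icc (0 : ℝ) β := ⟨ht.trans htt'.le, ht'⟩
  have h0I : (0 : ℝ) ∈ Icc (0 : ℝ) β := ⟨le_rfl, β.coe_nonneg⟩
  have hi := intervalIntegrable_thrClockRate hint htI ht'I
  have hsub : thrClock W A t' - thrClock W A t = ∫ r in t..t', thrClockRate W A r := by
    rw [thrClock, thrClock, integral_interval_sub_left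
      (intervalIntegrable_thrClockRate hint h0I ht'I) (intervalIntegrable_thrClockRate hint h0I htI)]
  rw [hsub]
  constructor
  · exact intervalIntegral_pos_of_pos_on hi (fun r _ ↦ (thrClockRate_pos_le_one W A r).1) htt'
  · have := integral_mono_on htt'.le hi (intervalIntegrable_const)
      (fun r _ ↦ (thrClockRate_pos_le_one W A r).2)
    rwa [intervalIntegral.integral_const, smul_eq_mul, mul_one] at this

/-- **The clock is strictly increasing on `[0, β]`.** [folklore] -/
theorem strictMonoOn_thrClock : StrictMonoOn (thrClock W A) (Icc (0 : ℝ) β) := by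
  intro t ht t' ht' hlt
  have := (thrClock_sub_mem hint ht.1 hlt ht'.2).1
  linarith

/-- **The clock is `1`-Lipschitz on `[0, β]`.** [folklore] -/
theorem abs_thrClock_sub_le {t t' : ℝ} (ht : t ∈ Icc (0 : ℝ) β) (ht' : t' ∈ Icc (0 : ℝ) β) :
    |thrClock W A t' - thrClock W A t| ≤ |t' - t| := by
  rcases lt_trichotomy t t' with h | rfl | h
  · have := thrClock_sub_mem hint ht.1 h ht'.2
    rw [abs_of_nonneg this.1.le, abs_of_nonneg (sub_nonneg.2 h.le)]; exact this.2
  · simp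
  · have := thrClock_sub_mem hint ht'.1 h ht.2
    rw [abs_sub_comm, abs_of_nonneg this.1.le, abs_sub_comm, abs_of_nonneg (sub_nonneg.2 h.le)]
    exact this.2

/-- The clock is continuous on `[0, β]`. [folklore] -/
theorem continuousOn_thrClock : ContinuousOn (thrClock W A) (Icc (0 : ℝ) β) := by
  rw [Metric.continuousOn_iff]
  intro t ht ε hε
  refine ⟨ε, hε, fun t' ht' htt' ↦ ?_⟩
  rw [Real.dist_eq] at htt' ⊢
  exact (abs_thrClock_sub_le hint ht ht').trans_lt htt'

/-- `0 ≤ σ t ≤ t` on `[0, β]`. [folklore] -/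
theorem thrClock_mem {t : ℝ} (ht : t ∈ Icc (0 : ℝ) β) : thrClock W A t ∈ Icc (0 : ℝ) t := by
  rcases ht.1.eq_or_lt with rfl | hpos
  · simp
  · have := thrClock_sub_mem hint le_rfl hpos ht.2
    rw [thrClock_zero, sub_zero, sub_zero] at this
    exact ⟨this.1.le, this.2⟩

/-- The image of `[0, β]` under the clock is `[0, σ β]`. [folklore] -/
theorem image_thrClock_Icc : thrClock W A '' Icc (0 : ℝ) β = Icc (0 : ℝ) (thrClock W A β) := by
  have h0 : (0 : ℝ) ≤ β := β.coe_nonneg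
  have hmono := (strictMonoOn_thrClock hint).monotoneOn
  apply Subset.antisymm
  · rintro _ ⟨t, ht, rfl⟩
    exact ⟨(thrClock_mem hint ht).1, hmono ht ⟨h0, le_rfl⟩ ht.2⟩
  · intro q hq
    have := intermediate_value_Icc h0 (continuousOn_thrClock hint)
    rw [thrClock_zero] at this
    exact this hq

/-! ### The inverse clock -/

/-- `τ q ∈ [0, β]` and `σ (τ q) = q` for `q ∈ [0, σ β]`. [folklore] -/
theorem thrClockInv_spec {q : ℝ} (hq : q ∈ Icc (0 : ℝ) (thrClock W A β)) :
    thrClockInv W A β q ∈ Icc (0 : ℝ) β ∧ thrClock W A (thrClockInv W A β q) = q := by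
  have : ∃ t ∈ Icc (0 : ℝ) β, thrClock W A t = q := by
    have h := (image_thrClock_Icc hint).symm.subset hq
    exact h
  exact Function.invFunOn_pos this

/-- `σ (τ q) = q`. [folklore] -/
theorem thrClock_thrClockInv {q : ℝ} (hq : q ∈ Icc (0 : ℝ) (thrClock W A β)) :
    thrClock W A (thrClockInv W A β q) = q :=
  (thrClockInv_spec hint hq).2

/-- `τ (σ t) = t` for `t ∈ [0, β]`. [folklore] -/
theorem thrClockInv_thrClock {t : ℝ} (ht : t ∈ Icc (0 : ℝ) β) :
    thrClockInv W A β (thrClock W A t) = t := by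
  have hmono := strictMonoOn_thrClock hint
  have hq : thrClock W A t ∈ Icc (0 : ℝ) (thrClock W A β) :=
    ⟨(thrClock_mem hint ht).1, hmono.monotoneOn ht ⟨β.coe_nonneg, le_rfl⟩ ht.2⟩
  exact hmono.injOn (thrClockInv_spec hint hq).1 ht (thrClock_thrClockInv hint hq)

/-- `τ 0 = 0`. [folklore] -/
theorem thrClockInv_zero : thrClockInv W A β 0 = 0 := by
  have := thrClockInv_thrClock hint (t := 0) ⟨le_rfl, β.coe_nonneg⟩
  rwa [thrClock_zero] at this

/-- **`τ` is strictly increasing on `[0, σ β]`.** [folklore] -/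
theorem strictMonoOn_thrClockInv : StrictMonoOn (thrClockInv W A β) (Icc (0 : ℝ) (thrClock W A β)) := by
  intro q hq q' hq' hlt
  have hmono := strictMonoOn_thrClock hint
  rw [← hmono.lt_iff_lt (thrClockInv_spec hint hq).1 (thrClockInv_spec hint hq').1,
    thrClock_thrClockInv hint hq, thrClock_thrClockInv hint hq']
  exact hlt

/-- The image of `[0, σ β]` under `τ` is `[0, β]`. [folklore] -/
theorem image_thrClockInv_Icc :
    thrClockInv W A β '' Icc (0 : ℝ) (thrClock W A β) = Icc (0 : ℝ) β := by
  apply Subset.antisymm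
  · rintro _ ⟨q, hq, rfl⟩; exact (thrClockInv_spec hint hq).1
  · intro t ht
    refine ⟨thrClock W A t, ?_, thrClockInv_thrClock hint ht⟩
    rw [← image_thrClock_Icc hint]; exact mem_image_of_mem _ ht

/-- **`τ` is continuous on `[0, σ β]`** (a monotone map of `[0, σ β]` ONTO the interval `[0, β]`).
[folklore] -/
theorem continuousOn_thrClockInv : ContinuousOn (thrClockInv W A β) (Icc (0 : ℝ) (thrClock W A β)) := by
  set S : ℝ := thrClock W A β with hS
  set g := thrClockInv W A β with hg
  have hmono : MonotoneOn g (Icc (0 : ℝ) S) := (strictMonoOn_thrClockInv hint).monotoneOn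
  have himg := image_thrClockInv_Icc hint
  have hS0 : 0 ≤ S := (thrClock_mem hint ⟨β.coe_nonneg, le_rfl⟩).1
  intro q hq
  -- split into the left and the right half-neighbourhoods inside `[0, S]`
  have hL : ContinuousWithinAt g (Icc (0 : ℝ) S ∩ Iic q) q := by
    rcases hq.1.eq_or_lt with h | h0q
    · -- `q = 0`: the left part is `{0}`
      have : Icc (0 : ℝ) S ∩ Iic q = {q} := by
        ext x; simp only [mem_inter_iff, mem_Icc, mem_Iic, mem_singleton_iff]
        constructor
        · rintro ⟨⟨h1, -⟩, h2⟩; rw [← h] at h2 ⊢; exact le_antisymm h2 h1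
        · rintro rfl; exact ⟨⟨hq.1, hq.2⟩, le_rfl⟩
      rw [this]; exact continuousWithinAt_singleton
    · -- `0 < q`: monotone with image a left-neighbourhood of `g q` in `[0, β]`
      have hmono' : MonotoneOn g (Icc (0 : ℝ) q) := hmono.mono (Icc_subset_Icc_right hq.2)
      have hs : Icc (0 : ℝ) q ∈ 𝓝[≤] q := Icc_mem_nhdsLE h0q
      have hgq := (thrClockInv_spec hint hq).1
      have hg0 : g 0 = 0 := thrClockInv_zero hint
      have himg' : g '' Icc (0 : ℝ) q = Icc (0 : ℝ) (g q) := by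
        apply Subset.antisymm
        · rintro _ ⟨x, hx, rfl⟩
          exact ⟨by rw [← hg0]; exact hmono ⟨le_rfl, hS0⟩ ⟨hx.1, hx.2.trans hq.2⟩ hx.1,
            hmono ⟨hx.1, hx.2.trans hq.2⟩ hq hx.2⟩
        · intro t ht
          have htβ : t ∈ Icc (0 : ℝ) β := ⟨ht.1, ht.2.trans hgq.2⟩
          refine ⟨thrClock W A t, ⟨(thrClock_mem hint htβ).1, ?_⟩, thrClockInv_thrClock hint htβ⟩
          have := (strictMonoOn_thrClock hint).monotoneOn htβ hgq ht.2
          rwa [thrClock_thrClockInv hint hq] at this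
      have hfs : g '' Icc (0 : ℝ) q ∈ 𝓝[≤] g q := by
        rw [himg']
        rcases hgq.1.eq_or_lt with h0 | hpos
        · -- `g q = 0` forces `q = 0`: excluded
          exfalso
          have := thrClock_thrClockInv hint hq
          have h0' : g q = 0 := by rw [hg]; exact h0.symm
          rw [show thrClockInv W A β q = g q from rfl, h0', thrClock_zero] at this
          exact h0q.ne this
        · exact Icc_mem_nhdsLE hpos
      have h := continuousWithinAt_left_of_monotoneOn_of_image_mem_nhdsWithin hmono' hs hfs
      exact h.mono fun x hx ↦ hx.2
  have hR : ContinuousWithinAt g (Icc (0 : ℝ) S ∩ Ici q) q := by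
    rcases hq.2.eq_or_lt with h | hqS
    · have : Icc (0 : ℝ) S ∩ Ici q = {q} := by
        ext x; simp only [mem_inter_iff, mem_Icc, mem_Ici, mem_singleton_iff]
        constructor
        · rintro ⟨⟨-, h1⟩, h2⟩; rw [h] at h2 ⊢; exact le_antisymm h1 h2
        · rintro rfl; exact ⟨⟨hq.1, hq.2⟩, le_rfl⟩
      rw [this]; exact continuousWithinAt_singleton
    · have hmono' : MonotoneOn g (Icc q S) := hmono.mono (Icc_subset_Icc_left hq.1)
      have hs : Icc q S ∈ 𝓝[≥] q := Icc_mem_nhdsGE hqS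
      have hgq := (thrClockInv_spec hint hq).1
      have hSspec := (thrClockInv_spec hint (q := S) ⟨hS0, le_rfl⟩).1
      have hgS : g S = β := by
        have := thrClockInv_thrClock hint (t := β) ⟨β.coe_nonneg, le_rfl⟩
        rwa [← hS] at this
      have himg' : g '' Icc q S = Icc (g q) β := by
        apply Subset.antisymm
        · rintro _ ⟨x, hx, rfl⟩
          exact ⟨hmono hq ⟨hq.1.trans hx.1, hx.2⟩ hx.1,
            by rw [← hgS]; exact hmono ⟨hq.1.trans hx.1, hx.2⟩ ⟨hS0, le_rfl⟩ hx.2⟩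
        · intro t ht
          have htβ : t ∈ Icc (0 : ℝ) β := ⟨hgq.1.trans ht.1, ht.2⟩
          refine ⟨thrClock W A t, ⟨?_, ?_⟩, thrClockInv_thrClock hint htβ⟩
          · have := (strictMonoOn_thrClock hint).monotoneOn hgq htβ ht.1
            rwa [thrClock_thrClockInv hint hq] at this
          · exact (strictMonoOn_thrClock hint).monotoneOn htβ ⟨β.coe_nonneg, le_rfl⟩ ht.2
      have hfs : g '' Icc q S ∈ 𝓝[≥] g q := by
        rw [himg']
        rcases hgq.2.eq_or_lt with h1 | hlt
        · exfalso
          have := thrClock_thrClockInv hint hq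
          rw [h1] at this
          exact hqS.ne (by rw [hS]; exact this.symm)
        · exact Icc_mem_nhdsGE hlt
      have h := continuousWithinAt_right_of_monotoneOn_of_image_mem_nhdsWithin hmono' hs hfs
      exact h.mono fun x hx ↦ hx.2
  have : Icc (0 : ℝ) S = Icc (0 : ℝ) S ∩ Iic q ∪ Icc (0 : ℝ) S ∩ Ici q := by
    rw [← inter_union_distrib_left, Iic_union_Ici, inter_univ]
  rw [this]
  exact continuousWithinAt_union.2 ⟨hL, hR⟩

end Clock

/-! ### The clock in `ℝ≥0` -/

section ClockC

variable {β : ℝ≥0} (hint : IntegrableOn (thrClockRate W A) (Icc (0 : ℝ) β))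
include hint

/-- `(thrClockC t : ℝ) = σ t` for `t ≤ β`. [folklore] -/
theorem coe_thrClockC {t : ℝ≥0} (ht : t ≤ β) : (thrClockC W A t : ℝ) = thrClock W A t :=
  Real.coe_toNNReal _ (thrClock_mem hint ⟨t.coe_nonneg, NNReal.coe_le_coe.2 ht⟩).1

/-- `thrClockC 0 = 0`. [folklore] -/
theorem thrClockC_zero : thrClockC W A 0 = 0 := by
  apply NNReal.eq
  rw [coe_thrClockC hint (t := 0) bot_le, NNReal.coe_zero]; exact thrClock_zero W A

/-- `thrClockC` is strictly increasing on `[0, β]`. [folklore] -/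
theorem thrClockC_lt_thrClockC {s t : ℝ≥0} (hst : s < t) (ht : t ≤ β) : thrClockC W A s < thrClockC W A t := by
  rw [← NNReal.coe_lt_coe, coe_thrClockC hint (hst.le.trans ht), coe_thrClockC hint ht]
  exact strictMonoOn_thrClock hint ⟨s.coe_nonneg, NNReal.coe_le_coe.2 (hst.le.trans ht)⟩
    ⟨t.coe_nonneg, NNReal.coe_le_coe.2 ht⟩ (NNReal.coe_lt_coe.2 hst)

/-- `thrClockC` is monotone on `[0, β]`. [folklore] -/
theorem thrClockC_mono {s t : ℝ≥0} (hst : s ≤ t) (ht : t ≤ β) : thrClockC W A s ≤ thrClockC W A t := by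
  rcases hst.eq_or_lt with rfl | hlt
  · exact le_rfl
  · exact (thrClockC_lt_thrClockC hint hlt ht).le

/-- `τ (σ t) = t` in `ℝ≥0`, for `t ≤ β`. [folklore] -/
theorem toNNReal_thrClockInv_thrClockC {t : ℝ≥0} (ht : t ≤ β) :
    (thrClockInv W A β (thrClockC W A t)).toNNReal = t := by
  rw [coe_thrClockC hint ht, thrClockInv_thrClock hint ⟨t.coe_nonneg, NNReal.coe_le_coe.2 ht⟩,
    Real.toNNReal_coe]

/-- `σ (τ q) = q` in `ℝ≥0`, for `q ≤ σ β`. [folklore] -/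
theorem thrClockC_toNNReal_thrClockInv {q : ℝ≥0} (hq : q ≤ thrClockC W A β) :
    thrClockC W A (thrClockInv W A β q).toNNReal = q := by
  have hq' : (q : ℝ) ∈ Icc (0 : ℝ) (thrClock W A β) := by
    refine ⟨q.coe_nonneg, ?_⟩
    rw [← coe_thrClockC hint le_rfl]; exact NNReal.coe_le_coe.2 hq
  obtain ⟨hmem, hστ⟩ := thrClockInv_spec hint hq'
  have hle : (thrClockInv W A β q).toNNReal ≤ β := by
    rw [← NNReal.coe_le_coe, Real.coe_toNNReal _ hmem.1]; exact hmem.2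
  apply NNReal.eq
  rw [coe_thrClockC hint hle, Real.coe_toNNReal _ hmem.1, hστ]

/-- The through-swallow image driving value at `σ t` is `thrImageDriver W A t`, for `t ≤ β`. [folklore] -/
theorem thrImageDriverC_thrClockC {t : ℝ≥0} (ht : t ≤ β) :
    thrImageDriverC W A β (thrClockC W A t) = thrImageDriver W A t := by
  rw [thrImageDriverC, coe_thrClockC hint ht, min_eq_left ((strictMonoOn_thrClock hint).monotoneOn
      ⟨t.coe_nonneg, NNReal.coe_le_coe.2 ht⟩ ⟨β.coe_nonneg, le_rfl⟩ (NNReal.coe_le_coe.2 ht)),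
    thrClockInv_thrClock hint ⟨t.coe_nonneg, NNReal.coe_le_coe.2 ht⟩, Real.toNNReal_coe]

end ClockC

end Loewner

end Literature.Probability.RandomPlanarGeometry

end
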